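import Summits.CriticalPhenomena.PercolationContinuityZ3.Theorems.PercNearOneGluingNoHeavyQuantKnTowerLower
import Summits.CriticalPhenomena.PercolationContinuityZ3.Theorems.PercNearOneGluingNoHeavyQuantPkBridge
import Mathlib.Analysis.Complex.ExponentialBounds
import HarnessLib

/-!
# QUANT lane / PAPER-2 rate track (ARM-2 = constants bookkeeper, gen 3): the Peierls-lever window `pkLHi` ALSO grows at least like a
# tower of height two — the lever display's exponent is `log*₂ N / 2 + O(1)` from BOTH sides (Theorem C for the `ε = 2⁻⁸` cascade)

builds on p205010 (kernel theorem, internal audit signed; external expert review pending)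

Cell `prim-quant`, seat `prim-quant-arm-2`.  `…QuantKnTowerLower` (prim-quant-p3, p210474) VERBATIM with `kn ↦ pk`: the two exponentials
of Kozma–Nitzan's Lemma 10 (Step III seeds `pkSeeds ≥ 64^{seedBound}`, Step II levels `pkRad ≥ 64^{2d·Ncont}`) do not depend on the
Peierls constant, so the smaller window of `…QuantPkConstants` (`ε = 2⁻⁸`) still satisfies

* `PkSharp.pkLHi_ge_tower` — `2^(2^(2m+5)) ≤ pkLHi d m` (every `m`, `d ≥ 1`);
* `PkSharp.tower_le_scaleSeq_pkLHi` — `tower 2 (2j) ≤ scaleSeq (pkLHi d) (j+1)`;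
* **`PkSharp.two_mul_iterCount_pkLHi_le`** — `2 · iterCount (pkLHi d) N ≤ log*₂ N + 2` for all `N`.

With the bridge count `⌊(log*₂ N − knShiftC d)/2⌋ ≤ iterCount (pkLHi d) N` (`PkSharp.logStar_half_le_iterCount_pkLHi`, p247275) the exponent
of the Peierls-lever display `…QuantPkDisplays` (p248057) is `log*₂ N/2 + O(1)` from both sides, exactly as for the tree's window (p210474,
p211015): the lever moves the BASE only, the count not at all — inverse-tower decay and nothing more.  Generic pieces
(`le_one_div_critDelta`, `lowerStep_mono`, `iterExp_two_le_lowerIter`) are imported from `…QuantKnTowerLower`, not restated.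
[cite: KozmaNitzan2024, §4 Lemma 10 Steps II–III (seed and level counts)] [cite: DuminilcopinKozmaTassion2020, Proposition 1]
-/

noncomputable section

namespace Summit.CriticalPhenomena.PercolationContinuityZ3.Theorems.Quant.PkSharp

open MeasureTheory Literature.Probability.Percolation Literature.Probability.LatticeModels
open Literature.Probability.Percolation.KozmaNitzan Literature.Probability.Percolation.AKN
open Literature.Probability.Percolation.GM (HOct)

variable {d : ℕ}

/-! ## One constant bound (the other, `le_one_div_critDelta`, is imported) -/

/-- `1 ≤ log(1/δ_E)` (since `δ_E ≤ 1/3 < 1/e`). builds on p205010 (kernel theorem, internal audit signed; external expert review pending). [folklore] -/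
theorem one_le_log_one_div_pkDeltaE (d : ℕ) : 1 ≤ Real.log (1 / pkDeltaE d) := by
  have hpos : 0 < 1 / pkDeltaE d := one_div_pos.2 (pkDeltaE_pos d)
  rw [Real.le_log_iff_exp_le hpos]
  have h3 : Real.exp 1 < 3 := lt_trans Real.exp_one_lt_d9 (by norm_num)
  have hE : pkDeltaE d ≤ 1 / 3 := by
    have h1 := pkDeltaE_le_delta d
    have : pkDelta ≤ 1 / 3 := by unfold pkDelta; have := pkEps_le_one; have := pkEps_pos; linarith
    linarith
  have : (3 : ℝ) ≤ 1 / pkDeltaE d := by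
    rw [le_div_iff₀ (pkDeltaE_pos d)]; linarith
  linarith


/-! ## Lower bounds: two exponential levels are really there -/

/-- `2^{12 d · Ncont} ≤ pkLHi d m` (Step II's level count at base `1/critDelta ≥ 64`).
builds on p205010 (kernel theorem, internal audit signed; external expert review pending). [folklore] -/
theorem two_pow_Ncont_le_pkLHi (hd : 1 ≤ d) (m : ℕ) :
    2 ^ (12 * d * LData.Ncont d (pkM d m) (pkSeeds d m)) ≤ pkLHi d m := by
  have h64 := le_one_div_critDelta hd
  have hreal : ((2 ^ (12 * d * LData.Ncont d (pkM d m) (pkSeeds d m)) : ℕ) : ℝ) ≤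
      (1 / critDelta d) ^ (2 * d * LData.Ncont d (pkM d m) (pkSeeds d m)) / pkDelta := by
    have h1 : ((2 ^ (12 * d * LData.Ncont d (pkM d m) (pkSeeds d m)) : ℕ) : ℝ) =
        (64 : ℝ) ^ (2 * d * LData.Ncont d (pkM d m) (pkSeeds d m)) := by
      push_cast
      rw [show (64 : ℝ) = 2 ^ 6 by norm_num, ← pow_mul]; ring_nf
    rw [h1]
    have h2 : (64 : ℝ) ^ (2 * d * LData.Ncont d (pkM d m) (pkSeeds d m)) ≤
        (1 / critDelta d) ^ (2 * d * LData.Ncont d (pkM d m) (pkSeeds d m)) := pow_le_pow_left₀ (by norm_num) h64 _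
    have h3 : (1 / critDelta d) ^ (2 * d * LData.Ncont d (pkM d m) (pkSeeds d m)) ≤
        (1 / critDelta d) ^ (2 * d * LData.Ncont d (pkM d m) (pkSeeds d m)) / pkDelta :=
      le_div_self (by positivity) pkDelta_pos pkDelta_le_one
    exact h2.trans h3
  have hceil : 2 ^ (12 * d * LData.Ncont d (pkM d m) (pkSeeds d m)) ≤
      ⌈(1 / critDelta d) ^ (2 * d * LData.Ncont d (pkM d m) (pkSeeds d m)) / pkDelta⌉₊ := by
    have := hreal.trans (Nat.le_ceil _)
    exact_mod_cast this
  have hRT : 2 ^ (12 * d * LData.Ncont d (pkM d m) (pkSeeds d m)) ≤ pkRT d m := by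
    unfold pkRT pkRad; omega
  have h1 := two_pkRT_le_pkS d m
  have h2 := pkS_le_pkR d m
  unfold pkLHi; omega

/-- `2^{6·seedBound d M} ≤ pkSeeds d m` (Step III's seed count at base `1/critDelta ≥ 64`, using `log(1/δ_E) ≥ 1`).
builds on p205010 (kernel theorem, internal audit signed; external expert review pending). [folklore] -/
theorem pkSeeds_ge_two_pow (hd : 1 ≤ d) (m : ℕ) : 2 ^ (6 * seedBound d (pkM d m)) ≤ pkSeeds d m := by
  unfold pkSeeds
  set sB := seedBound d (pkM d m)
  have hreal : ((2 ^ (6 * sB) : ℕ) : ℝ) ≤ Real.log (1 / pkDeltaE d) / critDelta d ^ sB := by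
    have h0 : Real.log (1 / pkDeltaE d) / critDelta d ^ sB = Real.log (1 / pkDeltaE d) * (1 / critDelta d) ^ sB := by
      rw [one_div_pow]; field_simp
    rw [h0]
    have h1 : ((2 ^ (6 * sB) : ℕ) : ℝ) = (64 : ℝ) ^ sB := by push_cast; rw [pow_mul]; norm_num
    rw [h1]
    have h2 : (64 : ℝ) ^ sB ≤ (1 / critDelta d) ^ sB := pow_le_pow_left₀ (by norm_num) (le_one_div_critDelta hd) _
    have h3 := one_le_log_one_div_pkDeltaE d
    calc (64 : ℝ) ^ sB = 1 * 64 ^ sB := (one_mul _).symm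
      _ ≤ Real.log (1 / pkDeltaE d) * (1 / critDelta d) ^ sB := mul_le_mul h3 h2 (by positivity) (by linarith)
  exact_mod_cast hreal.trans (Nat.le_ceil _)

/-- `pkSeeds ≤ Ncont` (the separation box is nonempty). builds on p205010 (kernel theorem, internal audit signed; external expert review pending). [folklore] -/
theorem pkSeeds_le_Ncont (d m : ℕ) : pkSeeds d m ≤ LData.Ncont d (pkM d m) (pkSeeds d m) := by
  unfold LData.Ncont
  rw [card_box]
  exact Nat.le_mul_of_pos_right _ (by positivity)

/-- **`2^(2^(2m+5)) ≤ pkLHi d m`** for every `m`: the window top grows at least like a tower of height two.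
builds on p205010 (kernel theorem, internal audit signed; external expert review pending).
[cite: KozmaNitzan2024, §4 Lemma 10 Steps II–III] -/
theorem pkLHi_ge_tower (hd : 1 ≤ d) (m : ℕ) : 2 ^ (2 ^ (2 * m + 5)) ≤ pkLHi d m := by
  have h1 := two_pow_Ncont_le_pkLHi hd m
  have h2 := pkSeeds_le_Ncont d m
  have h3 := pkSeeds_ge_two_pow hd m
  have h4 : 2 * m + 5 ≤ 6 * seedBound d (pkM d m) := by
    have hM := lt_pkM d m
    unfold seedBound
    have h5 : 2 * pkM d m + 3 ≤ (2 * pkM d m + 3) ^ d := by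
      calc 2 * pkM d m + 3 = (2 * pkM d m + 3) ^ 1 := (pow_one _).symm
        _ ≤ _ := Nat.pow_le_pow_right (by omega) hd
    have h6 : (2 * pkM d m + 3) ^ d ≤ (2 * d + 1) * (2 * pkM d m + 3) ^ d := Nat.le_mul_of_pos_left _ (by omega)
    omega
  calc 2 ^ (2 ^ (2 * m + 5)) ≤ 2 ^ (2 ^ (6 * seedBound d (pkM d m))) :=
        Nat.pow_le_pow_right (by norm_num) (Nat.pow_le_pow_right (by norm_num) h4)
    _ ≤ 2 ^ pkSeeds d m := Nat.pow_le_pow_right (by norm_num) h3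
    _ ≤ 2 ^ LData.Ncont d (pkM d m) (pkSeeds d m) := Nat.pow_le_pow_right (by norm_num) h2
    _ ≤ 2 ^ (12 * d * LData.Ncont d (pkM d m) (pkSeeds d m)) :=
        Nat.pow_le_pow_right (by norm_num) (Nat.le_mul_of_pos_left _ (by omega))
    _ ≤ pkLHi d m := h1

/-! ## The scale sequence from below and the exponent from above -/

/-- The first scale `s 1 = pkLHi d 2` lies below every later one. builds on p205010 (kernel theorem, internal audit signed; external expert review pending). [folklore] -/
theorem pkLHi_two_le_scaleSeq (d j : ℕ) : pkLHi d 2 ≤ scaleSeq (pkLHi d) (j + 1) := by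
  have hmono := (strictMono_scaleSeq (L := pkLHi d) (PkSharp.le_pkLHi d)).monotone
  calc pkLHi d 2 = scaleSeq (pkLHi d) 1 := rfl
    _ ≤ scaleSeq (pkLHi d) (j + 1) := hmono (by omega)

/-- **Lower tower for the scale sequence**: `(x ↦ 2^(2^(2x+7)))^[j] (pkLHi d 2) ≤ s (j+1)`.
builds on p205010 (kernel theorem, internal audit signed; external expert review pending). [folklore] -/
theorem scaleSeq_pkLHi_ge (hd : 1 ≤ d) (j : ℕ) :
    (fun x : ℕ => 2 ^ (2 ^ (2 * x + 7)))^[j] (pkLHi d 2) ≤ scaleSeq (pkLHi d) (j + 1) := by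
  induction j with
  | zero => exact le_of_eq rfl
  | succ j ih =>
    rw [Function.iterate_succ_apply', scaleSeq_succ]
    set s := scaleSeq (pkLHi d) (j + 1) with hs
    have hmono := lowerStep_mono ih
    dsimp only at hmono ⊢
    calc 2 ^ (2 ^ (2 * ((fun x : ℕ => 2 ^ (2 ^ (2 * x + 7)))^[j] (pkLHi d 2)) + 7)) ≤ 2 ^ (2 ^ (2 * s + 7)) := hmono
      _ = 2 ^ (2 ^ (2 * (s + 1) + 5)) := by ring_nf
      _ ≤ pkLHi d (s + 1) := pkLHi_ge_tower hd (s + 1)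

/-- **The matching upper bound on the exponent**: if `N < (x ↦ 2^(2^(2x+7)))^[j] (pkLHi d 2)` then
`iterCount (pkLHi d) N ≤ j` — the rate `(1 - pkTauU d ^ (d·2^d))^{iterCount (pkLHi d) N}` of `oneArm_explicit_rate_criticalProbI_pk_orbit`
decays no faster than an inverse tower of height two per factor.
builds on p205010 (kernel theorem, internal audit signed; external expert review pending). [folklore] -/
theorem iterCount_pkLHi_le (hd : 1 ≤ d) {j N : ℕ} (hN : N < (fun x : ℕ => 2 ^ (2 ^ (2 * x + 7)))^[j] (pkLHi d 2)) :
    iterCount (pkLHi d) N ≤ j := by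
  by_contra h'
  have h : j + 1 ≤ iterCount (pkLHi d) N := by omega
  rcases Nat.eq_zero_or_pos N with rfl | hNpos
  · have := iterCount_le (pkLHi d) 0; omega
  have hmono := (strictMono_scaleSeq (L := pkLHi d) (PkSharp.le_pkLHi d)).monotone
  have h1 : scaleSeq (pkLHi d) (j + 1) ≤ scaleSeq (pkLHi d) (iterCount (pkLHi d) N) := hmono h
  have h2 := scaleSeq_iterCount_le (L := pkLHi d) hNpos
  have h3 := scaleSeq_pkLHi_ge hd j
  omega


/-! ## The `log*` form -/

/-- **`tower 2 (2j) ≤ scaleSeq (pkLHi d) (j+1)`**: the `(j+1)`-st scale of the lane's rate is at least a tower of `2j` twos.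
builds on p205010 (kernel theorem, internal audit signed; external expert review pending). [folklore] -/
theorem tower_le_scaleSeq_pkLHi (hd : 1 ≤ d) (j : ℕ) : tower 2 (2 * j) ≤ scaleSeq (pkLHi d) (j + 1) := by
  have h1 : 1 ≤ pkLHi d 2 := le_trans (by norm_num) (PkSharp.le_pkLHi d 2)
  calc tower 2 (2 * j) = iterExp 2 (2 * j) 1 := rfl
    _ ≤ iterExp 2 (2 * j) (pkLHi d 2) := iterExp_mono (by norm_num) _ h1
    _ ≤ (fun x : ℕ => 2 ^ (2 ^ (2 * x + 7)))^[j] (pkLHi d 2) := iterExp_two_le_lowerIter j _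
    _ ≤ scaleSeq (pkLHi d) (j + 1) := scaleSeq_pkLHi_ge hd j

/-- **`2 · iterCount (pkLHi d) N ≤ log*_2(N) + 2`** for every `N` (`d ≥ 1`): the exponent of the explicit rate
`π_{p_c}(N) ≤ (1 - pkEta d)^(iterCount (pkLHi d) N)` is at most `log*_2(N)/2 + 1` — with p4's lower bound `⌊log*_b N/3⌋ ≤ iterCount`
(R7a) the rate is `(1 - η_d)^{Θ(log* N)}`: an explicit function tending to `0` and nothing more.
builds on p205010 (kernel theorem, internal audit signed; external expert review pending).
[cite: KozmaNitzan2024, §4 Lemma 10 Steps II–III] -/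
theorem two_mul_iterCount_pkLHi_le (hd : 1 ≤ d) (N : ℕ) : 2 * iterCount (pkLHi d) N ≤ logStar 2 N + 2 := by
  rcases Nat.eq_zero_or_pos N with rfl | hN
  · have := iterCount_le (pkLHi d) 0; omega
  rcases Nat.eq_zero_or_pos (iterCount (pkLHi d) N) with h0 | hI
  · omega
  obtain ⟨i, hi⟩ : ∃ i, iterCount (pkLHi d) N = i + 1 := ⟨iterCount (pkLHi d) N - 1, by omega⟩
  have hs : scaleSeq (pkLHi d) (i + 1) ≤ N := by rw [← hi]; exact scaleSeq_iterCount_le hN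
  have ht : tower 2 (2 * i) ≤ N := (tower_le_scaleSeq_pkLHi hd i).trans hs
  have hl : 2 * i ≤ logStar 2 N := (le_logStar_iff (by norm_num) hN).2 ht
  omega

end Summit.CriticalPhenomena.PercolationContinuityZ3.Theorems.Quant.PkSharp

end
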